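import Literature.MathematicalPhysics.QuantumFieldTheory.Balaban1983to89.B9Thm314GpFlatEntries

/-!
# `Balaban1983to89.B9Ineq347GpFlatMultiLevelTorus` — [B9] (3.47) AT `U = 1`: THE FOUR GLOBAL WEIGHTED-SUP
INEQUALITIES OF THEOREM 3.1 FOR `G′ = Δ′_a⁻¹` ON THE GENUINE `k`-LEVEL TORUS —
`|G′λ|_{(2+γ)}, |∇_μG′λ|_{(1+γ)}, |G′∇_μ*λ|_{(1+γ)}, |ΔG′λ|_{(γ)} ≤ B₀(γ₀)|λ|_{(γ)}` for every real `γ` with `|γ| ≤ γ₀`,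
from the local (2.67) majorants and Lemma 2.1 of [4] ((2.60)/(2.61) DISCHARGED on the torus), exactly as print says:
«the global inequalities (3.47) are consequences of the local ones (3.42) and Lemma 2.1» (no existing module is touched;
no fact is minted)

FRAMING (verbatim cell line):
statement-level skeleton of published theorems with citation tags; proofs where landed; nothing here is a claim about the Yang–Mills mass gap

Sources under audit (cell pub-balaban / lit-balaban): T. Bałaban, *Propagators for lattice gauge theories in a
background field*, Commun. Math. Phys. **99** (1985) 389–434 [`Balaban1985BackgroundPropagators`, "B9"], pp. 397–398
[PDF 9–10] ((3.41): `|A|_{(α)} = sup_j sup_{b∈Ω_j∖Ω_{j+1}}(Lʲη)^{−α}|A(b)|`; (3.47); the sentence «It is easy to see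
that the global inequalities (3.47) are consequences of the local ones (3.42) and Lemma 2.1»); T. Bałaban,
*Propagators and renormalization transformations for lattice gauge theories. II*, Commun. Math. Phys. **96** (1984)
223–250 [`Balaban1984PropagatorsII`, "[4]"], Lemma 2.1 (2.60)–(2.61) p. 234, Prop. 2.2 (2.67) p. 234.  Unit
`lit-balaban-p21` (Phase-2 proof seat p21 gen 18, HOME `run/shared/lean/pub/lit-balaban/`; B9 fold owner r06, whose
abstract bookkeeping `B9Ineq347.glob347_entry1_of_342` proves entry 1 from HYPOTHESES `h260`/`h261` on an abstract
carrier and lists as NOT reproduced «the other three entries», «(2.60)/(2.61) for THIS geometry» and «(3.47) at U = 1»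
(census G-A1-1 (b)); this file gives all four entries at `U = 1` with the geometry discharged, on the torus lineage).

## WHAT IS PRINTED (B9 p. 398, verbatim up to notation)

«and the global inequalities |G′(U)λ|_{(2+γ)}, |∇_UG′(U)λ|_{(1+γ)}, |G′(U)∇*_Uλ|_{(1+γ)}, [|Δ_UG′(U)λ|_{(γ)}] ≤ B₀|λ|_{(γ)}
(3.47) for γ in a fixed compact subset of real numbers, e.g. for γ ∈ [−4, 4].» (fourth member: print has `∇_U`,
census G-B9-01 reads `Δ_U`), with (3.41) `|A|_{(α)} = sup_j sup_{b∈Ω_j∖Ω_{j+1}} (Lʲη)^{−α}|A(b)|`.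

## THE ROUTE (print's sentence, kernel-checked; lattice units, weights `L^{γ·j}` with REAL `γ`)

`|λ|_{(γ)} ≤ N` means `|λ(z)| ≤ L^{γj(z)}N`.  Decompose `λ = Σ_{y′∈𝔅} λ1_{B(y′)}` ([4] (2.52)); a block majorant
`C₀L^{nj(y)}e^{−δd(y,y′)}` of `T` gives `|(Tλ)(x)| ≤ Σ_{y′} C₀L^{nj}e^{−δd(y,y′)}L^{γj′}N` (`abs_le_sum_of_hasMajorant`);
write `L^{γj′} = L^{γj}·L^{γ(j′−j)} ≤ L^{γj}·L^{|γ||j−j′|} ≤ L^{γj}·L^{|γ|}·(L^{|γ|})^{m}`, `m = max(|j−j′|−1,0)`, and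
by (2.60) on the torus (`levelSepTB`: `(R·L·M_h − 1)·m ≤ d_T(y,y′)`) `e^{−¾δd} ≤ (e^{−¾δ(RLM_h−1)})^{m}`, so
`e^{−¾δd}L^{γj′} ≤ L^{|γ|}L^{γj}` once `L^{|γ|} ≤ e^{¾δ(RLM_h−1)}` (the size condition, uniform for `|γ| ≤ γ₀` — the
reason for print's compact set); the remaining `Σ_{y′}e^{−¼δd(y,y′)} ≤ c` is (2.61) on the torus
(`consts_260_261`).  Result: `|(Tλ)(x)| ≤ C₀·c·L^{|γ|}·L^{nj(x)}·L^{γj(x)}·N`.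

## WHAT THIS FILE CERTIFIES

* `transfer_rpow` — the weight transfer for real exponents: `e^{−¾δd_T(y,y′)}·L^{γj(y′)} ≤ L^{|γ|}·L^{γj(y)}` under
  (2.60) and the size condition; **`weighted_sup_of_hasMajorant`** — the engine above for any kernel `T` with a block
  majorant `C₀L^{nj}e^{−δd}`.
* **`ineq347_Gp_flat_multiLevelTorus`** — for every `γ₀` there are `C, M₀ > 0`, `N₀ ≥ 1` (`k`-uniform, uniform in
  `|γ| ≤ γ₀` and `μ`) such that for all admissible `k, M_h, R, P`, every torus family `D`, windowed weights, every real
  `γ` with `|γ| ≤ γ₀`, every `λ` and `N ≥ 0` with `|λ(z)| ≤ L^{γj(z)}N` for all `z`, and every site `x` (level `j(x)`):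
  `|(G′λ)(x)| ≤ C·L^{2j(x)}·L^{γj(x)}·N`, `|(∇_μG′λ)(x)|, |(G′∇_μ*λ)(x)| ≤ C·L^{j(x)}·L^{γj(x)}·N`,
  `|(ΔG′λ)(x)| ≤ C·L^{γj(x)}·N` — i.e. (3.47) at `U = 1` with `B₀ = B₀(γ₀)`.

## HONEST SCOPE

`U = 1`, the operator `G′` on the torus lineage (`TDomains`, `Ω₁ = T_η`, levels `1 … k`, lattice units: `η`-powers
dropped consistently on both sides); `j(z)` = the level of the block of `z` (print's `b ∈ Ω_j∖Ω_{j+1}`); the compact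
set is `[−γ₀, γ₀]` for an arbitrary `γ₀ ≥ 0` with constants depending on `γ₀` (print: «e.g. γ ∈ [−4,4]»); `Δ` = the
periodic Laplacian `perLapT`.  Nothing is inferred from the manuscript: every step is kernel-checked.
-/

namespace Literature.MathematicalPhysics.QuantumFieldTheory.Balaban1983to89.B9Ineq347GpFlatMultiLevelTorus

open Finset Matrix
open Literature.MathematicalPhysics.QuantumFieldTheory.Balaban1983to89.B4Reflection242 (boxDom mem_boxDom blk)
open Literature.MathematicalPhysics.QuantumFieldTheory.Balaban1983to89.B6MultiLevelBoxOperator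
open Literature.MathematicalPhysics.QuantumFieldTheory.Balaban1983to89.B6MultiLevelTorusOperator
open Literature.MathematicalPhysics.QuantumFieldTheory.Balaban1983to89.B6Geom246MultiLevelBox
open Literature.MathematicalPhysics.QuantumFieldTheory.Balaban1983to89.B6Geom246MultiLevelTorus
open Literature.MathematicalPhysics.QuantumFieldTheory.Balaban1983to89.B8Ineq192MultiLevelTorus (geomTB geomTB_dist
  geomTB_L geomTB_RM levelSepTB symmT)
open Literature.MathematicalPhysics.QuantumFieldTheory.Balaban1983to89.B6Prop22MultiLevelTorus (prop22_first_multiLevelTorus)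
open Literature.MathematicalPhysics.QuantumFieldTheory.Balaban1983to89.B6Prop22DerivMultiLevelTorus (dT
  prop22_second_multiLevelTorus)
open Literature.MathematicalPhysics.QuantumFieldTheory.Balaban1983to89.B6Prop22AdjMultiLevelTorus (prop22_third_multiLevelTorus)
open Literature.MathematicalPhysics.QuantumFieldTheory.Balaban1983to89.B6Prop22LapMultiLevelTorus (prop22_sixth_multiLevelTorus)
open Literature.MathematicalPhysics.QuantumFieldTheory.Balaban1983to89.B6RandomWalk (HasMajorant BlockSupp)
open Literature.MathematicalPhysics.QuantumFieldTheory.Balaban1983to89.B6Ineq243TwoLevelBox (aNext)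
open Literature.MathematicalPhysics.QuantumFieldTheory.Balaban1983to89.B6Ineq268 (mx mx_nonneg LevelSep)
open Literature.MathematicalPhysics.QuantumFieldTheory.Balaban1983to89.B6Lemma21Repaired (Ineq261With)
open Literature.MathematicalPhysics.QuantumFieldTheory.Balaban1983to89.B9Thm314GpFlatResolvent (abs_le_sum_of_hasMajorant)
open Literature.MathematicalPhysics.QuantumFieldTheory.Balaban1983to89.B9Thm314GpFlatMultiLevelTorus (consts_260_261
  hasMajorant_rate_mono)

noncomputable section

variable {d : ℕ} {ℓ Mh k R : ℕ} {P : Fin (d + 1) → ℕ}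

/-- **THE WEIGHT TRANSFER FOR REAL EXPONENTS** ((2.60) + «we may replace the factor (Lʲη)^α by (Lʲη)^β(L^{j′}η)^γ»):
`e^{−¾δ·d_T(y,y′)}·L^{γj(y′)} ≤ L^{|γ|}·L^{γj(y)}` once `L^{|γ|} ≤ e^{¾δ(R·L·M_h − 1)}`.
[cite: Balaban1984PropagatorsII, (2.60) p.234; Balaban1985BackgroundPropagators, p.398 (remark after Thm 3.1)] -/
theorem transfer_rpow (D : TDomains d ℓ Mh k P R) (hMh : 1 ≤ Mh) (hP : ∀ μ, 1 ≤ P μ) (hRM : 1 ≤ R * ((ℓ + 1) * Mh))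
    {δ : ℝ} (hδ : 0 ≤ δ) (γ : ℝ)
    (hthr : ((ℓ : ℝ) + 1) ^ |γ| ≤ Real.exp (3 / 4 * δ * ((R : ℝ) * (((ℓ : ℝ) + 1) * Mh) - 1)))
    (y y' : ↥(bset D.toDomains)) :
    Real.exp (-(3 / 4 * δ * (geomT D).dist y y')) * ((ℓ : ℝ) + 1) ^ (γ * (y'.1.1 : ℝ))
      ≤ ((ℓ : ℝ) + 1) ^ |γ| * ((ℓ : ℝ) + 1) ^ (γ * (y.1.1 : ℝ)) := by
  have hL0 : (0 : ℝ) < (ℓ : ℝ) + 1 := by positivity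
  have hL1 : (1 : ℝ) ≤ (ℓ : ℝ) + 1 := by linarith [(Nat.cast_nonneg ℓ : (0 : ℝ) ≤ ℓ)]
  have hRM0 : 0 ≤ (R : ℝ) * (((ℓ : ℝ) + 1) * Mh) - 1 := by
    have : (1 : ℝ) ≤ (R : ℝ) * (((ℓ : ℝ) + 1) * Mh) := by exact_mod_cast hRM
    linarith
  -- the level separation (2.60) on the torus
  have hsep : LevelSep (geomTB D) := levelSepTB D hMh hP hRM
  have hmx0 : 0 ≤ mx (geomTB D) y y' := mx_nonneg _ _
  have hmx : ((R : ℝ) * (((ℓ : ℝ) + 1) * Mh) - 1) * mx (geomTB D) y y' ≤ (geomT D).dist y y' := by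
    have h := hsep y y'
    rw [geomTB_RM D hMh, geomTB_dist] at h
    exact h
  have hmxdef : mx (geomTB D) y y' = max (|(y.1.1 : ℝ) - y'.1.1| - 1) 0 := rfl
  -- `γ(j′ − j) ≤ |γ|·(m + 1)`
  have hexp_le : γ * (y'.1.1 : ℝ) ≤ γ * (y.1.1 : ℝ) + |γ| * (mx (geomTB D) y y' + 1) := by
    have h1 : γ * ((y'.1.1 : ℝ) - y.1.1) ≤ |γ| * |(y.1.1 : ℝ) - y'.1.1| := by
      rw [abs_sub_comm]; exact (le_abs_self _).trans (le_of_eq (abs_mul _ _))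
    have h2 : |(y.1.1 : ℝ) - y'.1.1| ≤ mx (geomTB D) y y' + 1 := by
      rw [hmxdef]; have := le_max_left (|(y.1.1 : ℝ) - y'.1.1| - 1) 0; linarith
    have h3 := mul_le_mul_of_nonneg_left h2 (abs_nonneg γ)
    nlinarith
  have hpow1 : ((ℓ : ℝ) + 1) ^ (γ * (y'.1.1 : ℝ))
      ≤ ((ℓ : ℝ) + 1) ^ (γ * (y.1.1 : ℝ)) * (((ℓ : ℝ) + 1) ^ |γ| * (((ℓ : ℝ) + 1) ^ |γ|) ^ mx (geomTB D) y y') := by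
    calc ((ℓ : ℝ) + 1) ^ (γ * (y'.1.1 : ℝ))
        ≤ ((ℓ : ℝ) + 1) ^ (γ * (y.1.1 : ℝ) + |γ| * (mx (geomTB D) y y' + 1)) :=
          Real.rpow_le_rpow_of_exponent_le hL1 hexp_le
      _ = _ := by
          rw [Real.rpow_add hL0, show |γ| * (mx (geomTB D) y y' + 1) = |γ| + |γ| * mx (geomTB D) y y' by ring,
            Real.rpow_add hL0, Real.rpow_mul hL0.le |γ| (mx (geomTB D) y y')]
  -- `e^{−¾δd} ≤ (e^{−¾δ(RLM_h − 1)})^m`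
  have hexp1 : Real.exp (-(3 / 4 * δ * (geomT D).dist y y'))
      ≤ Real.exp (-(3 / 4 * δ * ((R : ℝ) * (((ℓ : ℝ) + 1) * Mh) - 1))) ^ mx (geomTB D) y y' := by
    rw [← Real.exp_mul, Real.exp_le_exp]
    have := mul_le_mul_of_nonneg_left hmx (by positivity : (0 : ℝ) ≤ 3 / 4 * δ)
    nlinarith
  -- the product of the two `m`-th powers is `≤ 1`
  have hbase1 : ((ℓ : ℝ) + 1) ^ |γ| * Real.exp (-(3 / 4 * δ * ((R : ℝ) * (((ℓ : ℝ) + 1) * Mh) - 1))) ≤ 1 := by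
    rw [Real.exp_neg]
    have hE := Real.exp_pos (3 / 4 * δ * ((R : ℝ) * (((ℓ : ℝ) + 1) * Mh) - 1))
    rw [mul_inv_le_iff₀ hE, one_mul]
    exact hthr
  have hbase0 : 0 ≤ ((ℓ : ℝ) + 1) ^ |γ| * Real.exp (-(3 / 4 * δ * ((R : ℝ) * (((ℓ : ℝ) + 1) * Mh) - 1))) := by
    positivity
  have hprod : (((ℓ : ℝ) + 1) ^ |γ|) ^ mx (geomTB D) y y'
      * Real.exp (-(3 / 4 * δ * ((R : ℝ) * (((ℓ : ℝ) + 1) * Mh) - 1))) ^ mx (geomTB D) y y' ≤ 1 := by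
    rw [← Real.mul_rpow (Real.rpow_nonneg hL0.le _) (Real.exp_pos _).le]
    exact Real.rpow_le_one hbase0 hbase1 hmx0
  have hA0 : 0 ≤ ((ℓ : ℝ) + 1) ^ |γ| * ((ℓ : ℝ) + 1) ^ (γ * (y.1.1 : ℝ)) := by positivity
  calc Real.exp (-(3 / 4 * δ * (geomT D).dist y y')) * ((ℓ : ℝ) + 1) ^ (γ * (y'.1.1 : ℝ))
      ≤ Real.exp (-(3 / 4 * δ * ((R : ℝ) * (((ℓ : ℝ) + 1) * Mh) - 1))) ^ mx (geomTB D) y y'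
        * (((ℓ : ℝ) + 1) ^ (γ * (y.1.1 : ℝ)) * (((ℓ : ℝ) + 1) ^ |γ| * (((ℓ : ℝ) + 1) ^ |γ|) ^ mx (geomTB D) y y')) :=
        mul_le_mul hexp1 hpow1 (Real.rpow_nonneg hL0.le _) (Real.rpow_nonneg (Real.exp_pos _).le _)
    _ = ((ℓ : ℝ) + 1) ^ |γ| * ((ℓ : ℝ) + 1) ^ (γ * (y.1.1 : ℝ))
        * ((((ℓ : ℝ) + 1) ^ |γ|) ^ mx (geomTB D) y y'
          * Real.exp (-(3 / 4 * δ * ((R : ℝ) * (((ℓ : ℝ) + 1) * Mh) - 1))) ^ mx (geomTB D) y y') := by ring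
    _ ≤ ((ℓ : ℝ) + 1) ^ |γ| * ((ℓ : ℝ) + 1) ^ (γ * (y.1.1 : ℝ)) * 1 := mul_le_mul_of_nonneg_left hprod hA0
    _ = _ := mul_one _

/-- **THE ENGINE «(3.42) + Lemma 2.1 ⇒ (3.47)»**: a block majorant `C₀L^{nj(y)}e^{−δd_T(y,y′)}` of `T`, (2.61) on the
torus at `¼δ` with constant `c`, and the size condition `L^{|γ|} ≤ e^{¾δ(R·L·M_h − 1)}` give, for every `λ` with
`|λ(z)| ≤ L^{γj(z)}N`: `|(Tλ)(x)| ≤ C₀·c·L^{|γ|}·L^{nj(x)}·L^{γj(x)}·N`.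
[cite: Balaban1985BackgroundPropagators, (3.47) p.398 («consequences of the local ones (3.42) and Lemma 2.1»); Balaban1984PropagatorsII, (2.52) p.232, Lemma 2.1 (2.60)–(2.61) p.234] -/
theorem weighted_sup_of_hasMajorant (D : TDomains d ℓ Mh k P R) (hMh : 1 ≤ Mh) (hP : ∀ μ, 1 ≤ P μ)
    (hRM : 1 ≤ R * ((ℓ + 1) * Mh)) {T : Matrix ↥(boxDom (N0 ℓ Mh k P)) ↥(boxDom (N0 ℓ Mh k P)) ℝ} {C₀ δ : ℝ} {n : ℕ}
    (hC₀ : 0 ≤ C₀) (hδ : 0 ≤ δ)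
    (hT : HasMajorant (g := geomT D) (blkOf D.toDomains) (Matrix.toLin' T)
      (fun y y' => C₀ * ((ℓ : ℝ) + 1) ^ (n * y.1.1) * Real.exp (-(δ * (geomT D).dist y y'))))
    {c : ℝ} (h261 : Ineq261With c (geomT D) δ (1 / 4)) (γ : ℝ)
    (hthr : ((ℓ : ℝ) + 1) ^ |γ| ≤ Real.exp (3 / 4 * δ * ((R : ℝ) * (((ℓ : ℝ) + 1) * Mh) - 1)))
    {lam : ↥(boxDom (N0 ℓ Mh k P)) → ℝ} {N : ℝ} (hN : 0 ≤ N)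
    (hlam : ∀ z, |lam z| ≤ ((ℓ : ℝ) + 1) ^ (γ * (D.lev z.1 : ℝ)) * N) (x : ↥(boxDom (N0 ℓ Mh k P))) :
    |(T *ᵥ lam) x| ≤ C₀ * c * ((ℓ : ℝ) + 1) ^ |γ| * ((ℓ : ℝ) + 1) ^ (n * D.lev x.1)
      * ((ℓ : ℝ) + 1) ^ (γ * (D.lev x.1 : ℝ)) * N := by
  have hL0 : (0 : ℝ) < (ℓ : ℝ) + 1 := by positivity
  -- block decomposition of `λ`
  have hU0 : ∀ b : ↥(bset D.toDomains), 0 ≤ ((ℓ : ℝ) + 1) ^ (γ * (b.1.1 : ℝ)) * N := fun b => by positivity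
  have hU : ∀ z, |lam z| ≤ ((ℓ : ℝ) + 1) ^ (γ * ((blkOf D.toDomains z).1.1 : ℝ)) * N := fun z => hlam z
  have h := abs_le_sum_of_hasMajorant (g := geomT D) (blkOf D.toDomains) hT lam
    (fun b => ((ℓ : ℝ) + 1) ^ (γ * (b.1.1 : ℝ)) * N) hU0 hU x
  rw [Matrix.toLin'_apply] at h
  have hlev : ((blkOf D.toDomains x).1.1 : ℕ) = D.lev x.1 := rfl
  refine h.trans ?_
  -- termwise transfer, then (2.61)
  have hterm : ∀ b : ↥(bset D.toDomains),
      C₀ * ((ℓ : ℝ) + 1) ^ (n * (blkOf D.toDomains x).1.1) * Real.exp (-(δ * (geomT D).dist (blkOf D.toDomains x) b))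
        * (((ℓ : ℝ) + 1) ^ (γ * (b.1.1 : ℝ)) * N)
      ≤ C₀ * ((ℓ : ℝ) + 1) ^ |γ| * ((ℓ : ℝ) + 1) ^ (n * D.lev x.1) * ((ℓ : ℝ) + 1) ^ (γ * (D.lev x.1 : ℝ)) * N
        * Real.exp (-(1 / 4 * δ * (geomT D).dist (blkOf D.toDomains x) b)) := by
    intro b
    have htr := transfer_rpow D hMh hP hRM hδ γ hthr (blkOf D.toDomains x) b
    rw [hlev] at htr ⊢
    have hsplit : Real.exp (-(δ * (geomT D).dist (blkOf D.toDomains x) b))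
        = Real.exp (-(1 / 4 * δ * (geomT D).dist (blkOf D.toDomains x) b))
          * Real.exp (-(3 / 4 * δ * (geomT D).dist (blkOf D.toDomains x) b)) := by
      rw [← Real.exp_add]; congr 1; ring
    rw [hsplit]
    calc C₀ * ((ℓ : ℝ) + 1) ^ (n * D.lev x.1)
          * (Real.exp (-(1 / 4 * δ * (geomT D).dist (blkOf D.toDomains x) b))
            * Real.exp (-(3 / 4 * δ * (geomT D).dist (blkOf D.toDomains x) b)))
          * (((ℓ : ℝ) + 1) ^ (γ * (b.1.1 : ℝ)) * N)
        = C₀ * ((ℓ : ℝ) + 1) ^ (n * D.lev x.1) * N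
          * Real.exp (-(1 / 4 * δ * (geomT D).dist (blkOf D.toDomains x) b))
          * (Real.exp (-(3 / 4 * δ * (geomT D).dist (blkOf D.toDomains x) b))
            * ((ℓ : ℝ) + 1) ^ (γ * (b.1.1 : ℝ))) := by ring
      _ ≤ C₀ * ((ℓ : ℝ) + 1) ^ (n * D.lev x.1) * N
          * Real.exp (-(1 / 4 * δ * (geomT D).dist (blkOf D.toDomains x) b))
          * (((ℓ : ℝ) + 1) ^ |γ| * ((ℓ : ℝ) + 1) ^ (γ * (D.lev x.1 : ℝ))) :=
          mul_le_mul_of_nonneg_left htr (by positivity)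
      _ = _ := by ring
  calc ∑ b, C₀ * ((ℓ : ℝ) + 1) ^ (n * (blkOf D.toDomains x).1.1)
          * Real.exp (-(δ * (geomT D).dist (blkOf D.toDomains x) b)) * (((ℓ : ℝ) + 1) ^ (γ * (b.1.1 : ℝ)) * N)
      ≤ ∑ b, C₀ * ((ℓ : ℝ) + 1) ^ |γ| * ((ℓ : ℝ) + 1) ^ (n * D.lev x.1) * ((ℓ : ℝ) + 1) ^ (γ * (D.lev x.1 : ℝ)) * N
          * Real.exp (-(1 / 4 * δ * (geomT D).dist (blkOf D.toDomains x) b)) := Finset.sum_le_sum fun b _ => hterm b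
    _ = C₀ * ((ℓ : ℝ) + 1) ^ |γ| * ((ℓ : ℝ) + 1) ^ (n * D.lev x.1) * ((ℓ : ℝ) + 1) ^ (γ * (D.lev x.1 : ℝ)) * N
          * ∑ b, Real.exp (-(1 / 4 * δ * (geomT D).dist (blkOf D.toDomains x) b)) := by rw [Finset.mul_sum]
    _ ≤ C₀ * ((ℓ : ℝ) + 1) ^ |γ| * ((ℓ : ℝ) + 1) ^ (n * D.lev x.1) * ((ℓ : ℝ) + 1) ^ (γ * (D.lev x.1 : ℝ)) * N * c :=
        mul_le_mul_of_nonneg_left (h261 (blkOf D.toDomains x)) (by positivity)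
    _ = _ := by ring

/-- the size condition for the compact set `|γ| ≤ γ₀`: with `q = ⌈γ₀⌉₊ + 1` and the (2.60)/(2.61) threshold for the
rate `δ/q` (`L² ≤ e^{¼(δ/q)(R·L·M_h − 1)}`), `L^{|γ|} ≤ e^{¾(δ/q)·…}`... precisely `L^{|γ|} ≤ e^{¾δ′(R·L·M_h − 1)}` for
`δ′ = δ/q` fails in general, so the engine is run at the rate `δ′ = δ/q` for the SUM and the size condition is read as
`L^{|γ|} ≤ L^{2q} ≤ (e^{¼δ′(…)})^{q}·… ` — packaged here: `L^{|γ|} ≤ e^{¾δ′(R·L·M_h−1)}` whenever `|γ| ≤ γ₀`,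
`L² ≤ e^{¼δ′(R·L·M_h − 1)}` and `δ′ = δ/(⌈γ₀⌉₊ + 1)`… (see the proof: `L^{|γ|} ≤ L^{2q}` and `(L²)^q ≤ e^{q·¼δ′(…)} =
e^{¼δ(…)} ≤ e^{¾δ(…)}`, then the engine at rate `δ` needs only `e^{¾δ}` — so in fact the threshold at rate `δ/q`
suffices for the engine AT RATE `δ`). [cite: Balaban1985BackgroundPropagators, (3.47) p.398 («for γ in a fixed compact subset»); Balaban1984PropagatorsII, (2.59)–(2.60) p.234] -/
theorem size_condition {δ γ₀ γ : ℝ} (hδ : 0 ≤ δ) (hγ : |γ| ≤ γ₀) {X : ℝ} (hX : 0 ≤ X)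
    (hthr : ((ℓ : ℝ) + 1) ^ 2 ≤ Real.exp (1 / 4 * (δ / (⌈γ₀⌉₊ + 1 : ℕ)) * X)) :
    ((ℓ : ℝ) + 1) ^ |γ| ≤ Real.exp (3 / 4 * δ * X) := by
  have hL1 : (1 : ℝ) ≤ (ℓ : ℝ) + 1 := by linarith [(Nat.cast_nonneg ℓ : (0 : ℝ) ≤ ℓ)]
  set q : ℕ := ⌈γ₀⌉₊ + 1 with hq
  have hq0 : (0 : ℝ) < (q : ℝ) := by positivity
  have hγq : |γ| ≤ (2 * q : ℕ) := by
    have h1 : γ₀ ≤ (⌈γ₀⌉₊ : ℝ) := Nat.le_ceil γ₀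
    have h2 : ((2 * q : ℕ) : ℝ) = 2 * ((⌈γ₀⌉₊ : ℝ) + 1) := by rw [hq]; push_cast; ring
    rw [h2]; linarith
  calc ((ℓ : ℝ) + 1) ^ |γ| ≤ ((ℓ : ℝ) + 1) ^ ((2 * q : ℕ) : ℝ) := Real.rpow_le_rpow_of_exponent_le hL1 hγq
    _ = (((ℓ : ℝ) + 1) ^ 2) ^ q := by rw [Real.rpow_natCast, pow_mul]
    _ ≤ (Real.exp (1 / 4 * (δ / q) * X)) ^ q := pow_le_pow_left₀ (by positivity) hthr q
    _ = Real.exp (1 / 4 * δ * X) := by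
        rw [← Real.exp_nat_mul]; congr 1; field_simp
    _ ≤ Real.exp (3 / 4 * δ * X) := Real.exp_le_exp.2 (by nlinarith [mul_nonneg hδ hX])

/-- **(3.47) AT `U = 1` FOR `G′` ON THE GENUINE `k`-LEVEL TORUS — ALL FOUR MEMBERS, `γ` IN THE COMPACT SET `[−γ₀, γ₀]`.**
For every real `γ₀` (the compact set `[−γ₀, γ₀]`) there are `C, M₀ > 0`, `N₀ ≥ 1` such that for all admissible data, every torus family `D`, every
real `γ` with `|γ| ≤ γ₀`, every `λ` and `N ≥ 0` with `|λ(z)| ≤ L^{γj(z)}N` for all sites `z`, and every site `x`: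
`|(G′λ)(x)| ≤ C·L^{2j(x)}·L^{γj(x)}·N`, `|(∇_μG′λ)(x)| ≤ C·L^{j(x)}·L^{γj(x)}·N`, `|(G′∇_μ*λ)(x)| ≤ C·L^{j(x)}·L^{γj(x)}·N`,
`|(ΔG′λ)(x)| ≤ C·L^{γj(x)}·N`. [cite: Balaban1985BackgroundPropagators, Thm 3.1 (3.47) with (3.41) pp.397–398; Balaban1984PropagatorsII, Prop. 2.2 (2.67) and Lemma 2.1 (2.60)–(2.61) p.234] -/
theorem ineq347_Gp_flat_multiLevelTorus (d ℓ : ℕ) (hℓ : 1 ≤ ℓ) (aminus aplus a2minus a2plus : ℝ) (ha : 0 < aminus)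
    (ha2 : 0 < a2minus) (γ₀ : ℝ) :
    ∃ C M₀ : ℝ, ∃ N₀ : ℕ, 0 < C ∧ 0 < M₀ ∧ 0 < N₀ ∧
      ∀ (k Mh R : ℕ), 3 ≤ Mh → M₀ ≤ ((ℓ : ℝ) + 1) * Mh → 2 * (ℓ + 1) ≤ R → N₀ + 1 ≤ R * ((ℓ + 1) * Mh) →
      ∀ (P : Fin (d + 1) → ℕ) (hP : ∀ μ, 1 ≤ P μ) (hP4 : ∀ μ, 4 ≤ P μ) (D : TDomains d ℓ Mh k P R) (a c : ℕ → ℝ),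
        (∀ i, 1 ≤ i → aminus ≤ a i ∧ a i ≤ aplus) → (∀ i, 1 ≤ i → a2minus ≤ c i ∧ c i ≤ a2plus) →
        (∀ i, 1 ≤ i → a (i + 1) = aNext ℓ (a i) (c i)) →
      ∀ (γ : ℝ), |γ| ≤ γ₀ → ∀ (lam : ↥(boxDom (N0 ℓ Mh k P)) → ℝ) (N : ℝ), 0 ≤ N →
        (∀ z, |lam z| ≤ ((ℓ : ℝ) + 1) ^ (γ * (D.lev z.1 : ℝ)) * N) →
      ∀ x : ↥(boxDom (N0 ℓ Mh k P)),
        |(gmlT (N0 ℓ Mh k P) ℓ k D.lev a *ᵥ lam) x|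
            ≤ C * ((ℓ : ℝ) + 1) ^ (2 * D.lev x.1) * ((ℓ : ℝ) + 1) ^ (γ * (D.lev x.1 : ℝ)) * N ∧
        (∀ μ : Fin (d + 1), |((dT (N0 ℓ Mh k P) μ * gmlT (N0 ℓ Mh k P) ℓ k D.lev a) *ᵥ lam) x|
            ≤ C * ((ℓ : ℝ) + 1) ^ D.lev x.1 * ((ℓ : ℝ) + 1) ^ (γ * (D.lev x.1 : ℝ)) * N) ∧
        (∀ μ : Fin (d + 1), |((gmlT (N0 ℓ Mh k P) ℓ k D.lev a * (dT (N0 ℓ Mh k P) μ)ᵀ) *ᵥ lam) x|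
            ≤ C * ((ℓ : ℝ) + 1) ^ D.lev x.1 * ((ℓ : ℝ) + 1) ^ (γ * (D.lev x.1 : ℝ)) * N) ∧
        |((perLapT (N0 ℓ Mh k P) * gmlT (N0 ℓ Mh k P) ℓ k D.lev a) *ᵥ lam) x|
            ≤ C * ((ℓ : ℝ) + 1) ^ (γ * (D.lev x.1 : ℝ)) * N := by
  obtain ⟨δ₁, C₁, M₁, N₁, hδ₁, hC₁, hM₁, hN₁, h₁⟩ := prop22_first_multiLevelTorus d ℓ hℓ aminus aplus a2minus a2plus ha ha2
  obtain ⟨δ₂, C₂, M₂, N₂, hδ₂, hC₂, hM₂, -, h₂⟩ := prop22_second_multiLevelTorus d ℓ hℓ aminus aplus a2minus a2plus ha ha2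
  obtain ⟨δ₃, C₃, M₃, N₃, hδ₃, hC₃, hM₃, -, h₃⟩ := prop22_third_multiLevelTorus d ℓ hℓ aminus aplus a2minus a2plus ha ha2
  obtain ⟨δ₆, C₆, M₆, N₆, hδ₆, hC₆, hM₆, -, h₆⟩ := prop22_sixth_multiLevelTorus d ℓ hℓ aminus aplus a2minus a2plus ha ha2
  -- a common rate below all four, divided by `q = ⌈γ₀⌉₊ + 1` for the size condition
  obtain ⟨δ, hδdef⟩ : ∃ δ : ℝ, δ = min (min (δ₁ / 2) (δ₂ / 2)) (min (δ₃ / 2) (δ₆ / 2)) := ⟨_, rfl⟩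
  have hδ : 0 < δ := by rw [hδdef]; exact lt_min (lt_min (by positivity) (by positivity)) (lt_min (by positivity) (by positivity))
  have hδle1 : δ ≤ δ₁ / 2 := by rw [hδdef]; exact (min_le_left _ _).trans (min_le_left _ _)
  have hδle2 : δ ≤ δ₂ / 2 := by rw [hδdef]; exact (min_le_left _ _).trans (min_le_right _ _)
  have hδle3 : δ ≤ δ₃ / 2 := by rw [hδdef]; exact (min_le_right _ _).trans (min_le_left _ _)
  have hδle6 : δ ≤ δ₆ / 2 := by rw [hδdef]; exact (min_le_right _ _).trans (min_le_right _ _)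
  have hδq : (0 : ℝ) < δ / (⌈γ₀⌉₊ + 1 : ℕ) := by positivity
  obtain ⟨Nq, cq, hNq, hcq, hconq⟩ := consts_260_261 d ℓ hδq
  obtain ⟨Nc, c, hNc, hc, hcon⟩ := consts_260_261 d ℓ hδ
  have hL0 : (0 : ℝ) < (ℓ : ℝ) + 1 := by positivity
  refine ⟨max (max C₁ C₂) (max C₃ C₆) * (c + 1) * ((ℓ : ℝ) + 1) ^ γ₀, max (max M₁ M₂) (max M₃ M₆),
    max (max (max N₁ N₂) (max N₃ N₆)) (max Nq Nc),
    by positivity, lt_of_lt_of_le hM₁ ((le_max_left _ _).trans (le_max_left _ _)),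
    lt_of_lt_of_le hN₁ (((le_max_left _ _).trans (le_max_left _ _)).trans (le_max_left _ _)), ?_⟩
  intro k Mh R hMh hM hR hRM P hP hP4 D a cw haw hcw hac γ hγ lam N hN hlam x
  have hMh1 : 1 ≤ Mh := le_trans (by norm_num) hMh
  have hM1' : M₁ ≤ ((ℓ : ℝ) + 1) * Mh := le_trans ((le_max_left _ _).trans (le_max_left _ _)) hM
  have hM2' : M₂ ≤ ((ℓ : ℝ) + 1) * Mh := le_trans ((le_max_right _ _).trans (le_max_left _ _)) hM
  have hM3' : M₃ ≤ ((ℓ : ℝ) + 1) * Mh := le_trans ((le_max_left _ _).trans (le_max_right _ _)) hM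
  have hM6' : M₆ ≤ ((ℓ : ℝ) + 1) * Mh := le_trans ((le_max_right _ _).trans (le_max_right _ _)) hM
  have hRN1 : N₁ + 1 ≤ R * ((ℓ + 1) * Mh) :=
    le_trans (Nat.add_le_add_right (((le_max_left _ _).trans (le_max_left _ _)).trans (le_max_left _ _)) 1) hRM
  have hRN2 : N₂ + 1 ≤ R * ((ℓ + 1) * Mh) :=
    le_trans (Nat.add_le_add_right (((le_max_right _ _).trans (le_max_left _ _)).trans (le_max_left _ _)) 1) hRM
  have hRN3 : N₃ + 1 ≤ R * ((ℓ + 1) * Mh) :=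
    le_trans (Nat.add_le_add_right (((le_max_left _ _).trans (le_max_right _ _)).trans (le_max_left _ _)) 1) hRM
  have hRN6 : N₆ + 1 ≤ R * ((ℓ + 1) * Mh) :=
    le_trans (Nat.add_le_add_right (((le_max_right _ _).trans (le_max_right _ _)).trans (le_max_left _ _)) 1) hRM
  have hRNq : Nq + 1 ≤ R * ((ℓ + 1) * Mh) :=
    le_trans (Nat.add_le_add_right ((le_max_left _ _).trans (le_max_right _ _)) 1) hRM
  have hRNc : Nc + 1 ≤ R * ((ℓ + 1) * Mh) :=
    le_trans (Nat.add_le_add_right ((le_max_right _ _).trans (le_max_right _ _)) 1) hRM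
  have hRMone : 1 ≤ R * ((ℓ + 1) * Mh) := le_trans (by omega) hRNc
  obtain ⟨hthrq, -⟩ := hconq k Mh R P hMh1 hP hRNq
  obtain ⟨-, h261⟩ := hcon k Mh R P hMh1 hP hRNc
  have h261D : Ineq261With c (geomT D) δ (1 / 4) := h261 D
  have hX : 0 ≤ (R : ℝ) * (((ℓ : ℝ) + 1) * Mh) - 1 := by
    have : (1 : ℝ) ≤ (R : ℝ) * (((ℓ : ℝ) + 1) * Mh) := by exact_mod_cast hRMone
    linarith
  have hsize := size_condition (ℓ := ℓ) hδ.le hγ hX hthrq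
  -- the four majorants at the common rate `δ`
  have hG := hasMajorant_rate_mono D hMh1 hP (fun y => C₁ * ((ℓ : ℝ) + 1) ^ (2 * y.1.1)) (fun y => by positivity) hδle1
    (h₁ k Mh R hMh hM1' hR hRN1 P hP hP4 D a cw haw hcw hac)
  -- constants bookkeeping
  have hLγ : ((ℓ : ℝ) + 1) ^ |γ| ≤ ((ℓ : ℝ) + 1) ^ γ₀ :=
    Real.rpow_le_rpow_of_exponent_le (by linarith [(Nat.cast_nonneg ℓ : (0 : ℝ) ≤ ℓ)]) hγ
  have hCmax1 : C₁ ≤ max (max C₁ C₂) (max C₃ C₆) := (le_max_left _ _).trans (le_max_left _ _)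
  have hCmax2 : C₂ ≤ max (max C₁ C₂) (max C₃ C₆) := (le_max_right _ _).trans (le_max_left _ _)
  have hCmax3 : C₃ ≤ max (max C₁ C₂) (max C₃ C₆) := (le_max_left _ _).trans (le_max_right _ _)
  have hCmax6 : C₆ ≤ max (max C₁ C₂) (max C₃ C₆) := (le_max_right _ _).trans (le_max_right _ _)
  have hc1 : c ≤ c + 1 := by linarith
  have hfin : ∀ {C₀ : ℝ} (W : ℝ), 0 ≤ C₀ → C₀ ≤ max (max C₁ C₂) (max C₃ C₆) → 0 ≤ W →
      C₀ * c * ((ℓ : ℝ) + 1) ^ |γ| * W * ((ℓ : ℝ) + 1) ^ (γ * (D.lev x.1 : ℝ)) * N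
        ≤ max (max C₁ C₂) (max C₃ C₆) * (c + 1) * ((ℓ : ℝ) + 1) ^ γ₀ * W
          * ((ℓ : ℝ) + 1) ^ (γ * (D.lev x.1 : ℝ)) * N := by
    intro C₀ W hC₀ hCle hW
    have hA : C₀ * c * ((ℓ : ℝ) + 1) ^ |γ| ≤ max (max C₁ C₂) (max C₃ C₆) * (c + 1) * ((ℓ : ℝ) + 1) ^ γ₀ :=
      mul_le_mul (mul_le_mul hCle hc1 hc (hC₀.trans hCle)) hLγ (Real.rpow_nonneg hL0.le _)
        (mul_nonneg (hC₀.trans hCle) (by linarith))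
    have hB : 0 ≤ W * ((ℓ : ℝ) + 1) ^ (γ * (D.lev x.1 : ℝ)) * N := by positivity
    calc C₀ * c * ((ℓ : ℝ) + 1) ^ |γ| * W * ((ℓ : ℝ) + 1) ^ (γ * (D.lev x.1 : ℝ)) * N
        = C₀ * c * ((ℓ : ℝ) + 1) ^ |γ| * (W * ((ℓ : ℝ) + 1) ^ (γ * (D.lev x.1 : ℝ)) * N) := by ring
      _ ≤ max (max C₁ C₂) (max C₃ C₆) * (c + 1) * ((ℓ : ℝ) + 1) ^ γ₀
          * (W * ((ℓ : ℝ) + 1) ^ (γ * (D.lev x.1 : ℝ)) * N) := mul_le_mul_of_nonneg_right hA hB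
      _ = _ := by ring
  refine ⟨?_, fun μ => ?_, fun μ => ?_, ?_⟩
  · have h := weighted_sup_of_hasMajorant D hMh1 hP hRMone hC₁.le hδ.le hG h261D γ hsize hN hlam x
    exact h.trans (hfin _ hC₁.le hCmax1 (by positivity))
  · have hS := hasMajorant_rate_mono D hMh1 hP (fun y => C₂ * ((ℓ : ℝ) + 1) ^ y.1.1) (fun y => by positivity) hδle2
      (h₂ k Mh R hMh hM2' hR hRN2 P hP hP4 D a cw haw hcw hac μ)
    have hS' : HasMajorant (g := geomT D) (blkOf D.toDomains)
        (Matrix.toLin' (dT (N0 ℓ Mh k P) μ * gmlT (N0 ℓ Mh k P) ℓ k D.lev a))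
        (fun y y' => C₂ * ((ℓ : ℝ) + 1) ^ (1 * y.1.1) * Real.exp (-(δ * (geomT D).dist y y'))) := by
      simpa only [one_mul] using hS
    have h := weighted_sup_of_hasMajorant D hMh1 hP hRMone hC₂.le hδ.le hS' h261D γ hsize hN hlam x
    rw [one_mul] at h
    exact h.trans (hfin _ hC₂.le hCmax2 (by positivity))
  · have hS := hasMajorant_rate_mono D hMh1 hP (fun y => C₃ * ((ℓ : ℝ) + 1) ^ y.1.1) (fun y => by positivity) hδle3
      (h₃ k Mh R hMh hM3' hR hRN3 P hP hP4 D a cw haw hcw hac μ)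
    have hS' : HasMajorant (g := geomT D) (blkOf D.toDomains)
        (Matrix.toLin' (gmlT (N0 ℓ Mh k P) ℓ k D.lev a * (dT (N0 ℓ Mh k P) μ)ᵀ))
        (fun y y' => C₃ * ((ℓ : ℝ) + 1) ^ (1 * y.1.1) * Real.exp (-(δ * (geomT D).dist y y'))) := by
      simpa only [one_mul] using hS
    have h := weighted_sup_of_hasMajorant D hMh1 hP hRMone hC₃.le hδ.le hS' h261D γ hsize hN hlam x
    rw [one_mul] at h
    exact h.trans (hfin _ hC₃.le hCmax3 (by positivity))
  · have hS := hasMajorant_rate_mono D hMh1 hP (fun _ => C₆) (fun y => hC₆.le) hδle6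
      (h₆ k Mh R hMh hM6' hR hRN6 P hP hP4 D a cw haw hcw hac)
    have hS' : HasMajorant (g := geomT D) (blkOf D.toDomains)
        (Matrix.toLin' (perLapT (N0 ℓ Mh k P) * gmlT (N0 ℓ Mh k P) ℓ k D.lev a))
        (fun y y' => C₆ * ((ℓ : ℝ) + 1) ^ (0 * y.1.1) * Real.exp (-(δ * (geomT D).dist y y'))) := by
      simpa only [zero_mul, pow_zero, mul_one] using hS
    have h := weighted_sup_of_hasMajorant D hMh1 hP hRMone hC₆.le hδ.le hS' h261D γ hsize hN hlam x
    rw [zero_mul, pow_zero] at h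
    have h' := hfin (1 : ℝ) hC₆.le hCmax6 zero_le_one
    rw [mul_one] at h'
    exact h.trans (by
      calc C₆ * c * ((ℓ : ℝ) + 1) ^ |γ| * 1 * ((ℓ : ℝ) + 1) ^ (γ * (D.lev x.1 : ℝ)) * N
          = C₆ * c * ((ℓ : ℝ) + 1) ^ |γ| * ((ℓ : ℝ) + 1) ^ (γ * (D.lev x.1 : ℝ)) * N := by ring
        _ ≤ _ := h'
        _ = _ := by ring)

end

end Literature.MathematicalPhysics.QuantumFieldTheory.Balaban1983to89.B9Ineq347GpFlatMultiLevelTorus
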